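import Literature.Analysis.FluidPDE.SignedPowers
import HarnessLib

/-!
# Seregin 2020, Lemma 2.2 (after Nazarov–Uraltseva 2012): the `C²` test profiles
# `H_p(τ) = ((κ - τ)₊)^p`, `p > 2`, of N–U Lemma 3.2 in the class-𝒱 energy class

Helper toward the stub `stub_seregin2020TypeII` of the crux `AxisymmetricKatoGlobal` (= the named
fact `Literature.Analysis.FluidPDE.Seregin2020_axisymmetricSingularPoint_typeII`, Seregin 2020,
Thm 2.1), reduced in the tree to `hWH′`. N–U test (3.9) with `(V - k)₋²`; the cell's energy
class admits `C²` convex profiles with `H'² ≤ 2HH''` vanishing on `[k, ∞)`, and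
`((κ - τ)₊)^p`, `p > 2`, `κ ≤ k`, is such a profile (`SignedPowers`); `p → 2⁺` recovers N–U's
constants (sibling `…Lemma22DensityAtom`).

* `rpowProfile_props` — `C²`, `H' ≤ 0 ≤ H, H''`, `H'² ≤ 2HH''`, `H = 0` on `[κ,∞)`,
  `H ≤ κ^p` on `[0,∞)`, `c^p ≤ H(τ)` for `τ ≤ κ - c`.

## References

* A. I. Nazarov, N. N. Uraltseva, St. Petersburg Math. J. 23 (2012) 93–115 = arXiv:1011.1888,
  §3, (3.2), (3.9). [NazarovUraltseva2012]
* G. Seregin, Anal. Math. Phys. 10 (2020), Paper 46 = arXiv:2006.04140, Lemma 2.2. [Seregin2020]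
-/

-- the problem directory repeats the summit name (D-0017); core's `dupNamespace` linter fires
set_option linter.dupNamespace false

noncomputable section

open MeasureTheory Set Function Filter Topology Metric Module
open scoped NNReal ENNReal

namespace Summit.NavierStokesRegularity.NavierStokesRegularity.Theorems.AxisymmetricKatoGlobal.EulerScaling

open Literature.Analysis.FluidPDE Literature.Analysis.FluidPDE.LeiZhang2011

/-- The profile `H_p(τ) = ((κ - τ)₊)^p`, `2 < p`, `κ > 0`: `C²`, `H' ≤ 0`, `H ≥ 0`, `H'' ≥ 0`,
`H'² ≤ 2HH''`, `H = 0` on `[κ, ∞)`, `H ≤ κ^p` on `[0, ∞)`, and `c^p ≤ H(τ)` whenever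
`0 ≤ c` and `τ ≤ κ - c`. [folklore] -/
theorem rpowProfile_props {p κ : ℝ} (hp : 2 < p) (hκ : 0 < κ) :
    ContDiff ℝ 2 (fun τ : ℝ => max (κ - τ) 0 ^ p) ∧
    (∀ v, deriv (fun τ : ℝ => max (κ - τ) 0 ^ p) v ≤ 0) ∧
    (∀ v, 0 ≤ max (κ - v) 0 ^ p) ∧
    (∀ v, 0 ≤ deriv (deriv fun τ : ℝ => max (κ - τ) 0 ^ p) v) ∧
    (∀ v, deriv (fun τ : ℝ => max (κ - τ) 0 ^ p) v ^ 2 ≤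
      2 * max (κ - v) 0 ^ p * deriv (deriv fun τ : ℝ => max (κ - τ) 0 ^ p) v) ∧
    (∀ v, κ ≤ v → max (κ - v) 0 ^ p = 0) ∧
    (∀ v, 0 ≤ v → max (κ - v) 0 ^ p ≤ κ ^ p) ∧
    (∀ c v, 0 ≤ c → v ≤ κ - c → c ^ p ≤ max (κ - v) 0 ^ p) := by
  have hp0 : 0 < p := by linarith
  refine ⟨contDiff_two_posPart_const_sub_rpow hp _, fun v => ?_, fun v => posPart_rpow_nonneg _ _,
    fun v => deriv_deriv_posPart_const_sub_rpow_nonneg hp _ v, fun v => ?_, fun v hv => ?_,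
    fun v hv => ?_, fun c v hc hv => ?_⟩
  · rw [deriv_posPart_const_sub_rpow hp]
    show -(p * max (κ - v) 0 ^ (p - 1)) ≤ 0
    have := posPart_rpow_nonneg (κ - v) (p - 1)
    nlinarith
  · have h := deriv_posPart_const_sub_rpow_sq_le hp κ v
    have hHH : 0 ≤ max (κ - v) 0 ^ p * deriv (deriv fun τ : ℝ => max (κ - τ) 0 ^ p) v :=
      mul_nonneg (posPart_rpow_nonneg _ _) (deriv_deriv_posPart_const_sub_rpow_nonneg hp _ v)
    have h2 : p / (p - 1) ≤ 2 := by
      rw [div_le_iff₀ (by linarith)]; linarith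
    calc deriv (fun τ : ℝ => max (κ - τ) 0 ^ p) v ^ 2
        ≤ p / (p - 1) * (max (κ - v) 0 ^ p * deriv (deriv fun τ : ℝ => max (κ - τ) 0 ^ p) v) := h
      _ ≤ 2 * (max (κ - v) 0 ^ p * deriv (deriv fun τ : ℝ => max (κ - τ) 0 ^ p) v) :=
          mul_le_mul_of_nonneg_right h2 hHH
      _ = _ := by ring
  · exact posPart_rpow_of_nonpos (by linarith) hp0.ne'
  · have h0 : 0 ≤ max (κ - v) 0 := le_max_right _ _
    have h1 : max (κ - v) 0 ≤ κ := max_le (by linarith) hκ.le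
    exact Real.rpow_le_rpow h0 h1 hp0.le
  · have h1 : c ≤ max (κ - v) 0 := le_max_of_le_left (by linarith)
    exact Real.rpow_le_rpow hc h1 hp0.le


end Summit.NavierStokesRegularity.NavierStokesRegularity.Theorems.AxisymmetricKatoGlobal.EulerScaling

end
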